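import Summits.CriticalPhenomena.PercolationContinuityZ3.Theorems.PercNearOneGluingNoHeavyQuantEffectiveTargetSteps
import Summits.CriticalPhenomena.PercolationContinuityZ3.Theorems.PercNearOneGluingNoHeavyQuantTargetPropertyAt
import Literature.Probability.Percolation.GMFiniteSize
import Literature.Probability.Percolation.UniquenessZone
import HarnessLib

/-!
# QUANT lane (R2.a): Kozma–Nitzan's Lemma 10 ADDITIVE and EFFECTIVE — scale-indexed hypotheses, explicit margin;
# the obligation `Quant.KNLemma10EffectiveAt d p` DISCHARGED

builds on p205010 (kernel theorem, internal audit signed; external expert review pending)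

Cell `prim-quant` (post-continuity programme, LANE 1), seat `prim-quant-p2` (METHOD = effective Kozma–Nitzan
reduction), memo `run/shared/lean/prim/quant/P2-EFFECTIVE-KN.md` §1 (step S2, second half); typed statements by
`prim-quant-stmt` in `…QuantTargetPropertyAt.lean` (`TargetPropertyAt`, `lemma10Delta`, `lemma10Radius`,
`KNLemma10EffectiveAt`).

`Quant.targetLemma_additive_core` re-runs Steps I–V of the tree's `KozmaNitzan.targetLemma_avoiding`
(`Literature/Probability/Percolation/KozmaNitzanTargetLemma.lean`) with
(1) the three LIMIT inputs turned into finite-volume HYPOTHESES at parameter `p`, indexed by the scales `m < M` and a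
    BOUNDED route-scale range `[ℓmax, ℓhi]`: (a) hittability of the target geometries `H` from the seed box `Λ_m` for
    `ℓ ∈ [ℓmax, ℓhi]`, (b) orthant-face linking at `(m, M)` (KN Lemma 9), (c) the uniqueness zone at `(m, M)` (KN Lemma 7),
    all at tolerance `δ²`; (d) the seed count as `(1 − p^{seedBound d M})^k ≤ δ`; (e) any margin
    `R ≥ 3M + ℓmax + 4 + ⌈(1−p)^{−2d·Ncont d M k}/δ⌉` (= `lemma10Radius d p δ M ℓmax k`);
(2) Step V replaced by the ADDITIVE Step V (`Quant.stepV_additive`), so that the conclusion is ADDITIVE with constant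
    `1`: `P_W(o ↔ B) − 6δ ≤ P_W(o ↔ T)` — no `IsHittable`, no `θ(p) > 0`, no Conjecture-3 hypothesis.
Corollaries: `Quant.targetLemma_additive` (targets in the tree's unbounded sense `IsTarget`),
`Quant.targetLemma_effective : … → TargetPropertyAt d p (7δ) δ H R` (δ LINEAR in ε),
`Quant.knLemma10EffectiveAt_holds : KNLemma10EffectiveAt d p` (the typer's R2.a obligation, whose
`lemma10Delta ε = ε·min(ε/4,1)/12 ≤ ε/7`), and the sanity link `Quant.targetProperty_of_theta_pos` (the tree's limit
lemmas discharge (a)–(e), recovering `KozmaNitzan.TargetProperty d p` from additive gluing with `δ(ε) = ε/7`).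
Why the bounded range `ℓhi` matters (memo §1–§3): at `p = p_c` hittability on an unbounded scale range is false, so
only the bounded form has a non-vacuous contrapositive.  No definitions; no sorries; standard axioms.
[cite: KozmaNitzan2024, §4 Lemma 10 (pp. 17–22)]
-/

noncomputable section

namespace Summit.CriticalPhenomena.PercolationContinuityZ3.Theorems.Quant

open MeasureTheory Literature.Probability.LatticeModels Literature.Probability.Percolation
  Literature.Probability.Percolation.KozmaNitzan

variable {d : ℕ}

/-! ## Lemma 10, additive and effective -/

/-- **Kozma–Nitzan's Lemma 10 with ADDITIVE loss and EXPLICIT scales** (the core statement; KN §4 pp. 17–22,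
tree `KozmaNitzan.targetLemma_avoiding` re-run with its three `obtain … := exists_…` lines turned into
hypotheses and its Step V replaced by `stepV_additive`).  Data: `0 ≤ p < 1`, a tolerance `δ > 0`, a finite family
`H` of geometries, scales `m < M`, a BOUNDED scale range `[ℓmax, ℓhi]` for the target routes, a seed count `k`
and a margin `R`.  Hypotheses, all finite-volume statements about `P_p = bondPercolation (zdGraph d) p`:
(a) every geometry of `H` is hit from `Λ_m` inside `ℓQ` with probability `> 1 − δ²` for every `ℓ ∈ [ℓmax, ℓhi]`;
(b) `Λ_m` is joined to every orthant face of `Λ_M` inside `Λ_M` with probability `> 1 − δ²` (KN Lemma 9 at `(m,M)`);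
(c) the uniqueness zone `uniqZone m M` has probability `> 1 − δ²` (KN Lemma 7 at `(m,M)`);
(d) `(1 − p^{seedBound d M})^k ≤ δ` (KN's `k`, Step III (19));
(e) `R ≥ 3M + ℓmax + 4 + ⌈(1−p)^{−2d·Ncont d M k}/δ⌉` (KN's `R = ⌈2k₂/δ⌉ + 5M`, Step II).
Conclusion: on every finitely supported weighting `W` with a lattice subbox `D ⊇ B⟨R⟩` at parameter `p`, for every
nonempty `T ⊆ D` that is a target whose routes have scales in `[R, ℓhi]`, and every source `o ∉ D`,
`P_W(o ↔ B) − 6δ ≤ P_W(o ↔ T)`.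
builds on p205010 (kernel theorem, internal audit signed; external expert review pending).
[cite: KozmaNitzan2024, §4 Lemma 10 (pp. 17–22)] -/
theorem targetLemma_additive_core [NeZero d] (p : unitInterval) (hp1 : (p : ℝ) < 1)
    {δ : ℝ} (hδ : 0 < δ) (H : List (Geom d)) {m M ℓmax ℓhi k R : ℕ} (hmM : m < M)
    (hhit : ∀ g ∈ H, ∀ ℓ : ℕ, ℓmax ≤ ℓ → ℓ ≤ ℓhi →
      1 - δ ^ 2 < (bondPercolation (zdGraph d) p).real (linkIn (↑(g.Qset ℓ 0)) (box d m) (g.Fset ℓ 0)))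
    (hface : ∀ (a : Fin d) (τ : Fin d → ℤˣ),
      1 - δ ^ 2 < (bondPercolation (zdGraph d) p).real (linkEvent (box d m) (orthantFace a τ M) M))
    (huniq : 1 - δ ^ 2 < (bondPercolation (zdGraph d) p).real (uniqZone m M))
    (hk : (1 - (p : ℝ) ^ seedBound d M) ^ k ≤ δ)
    (hR : 3 * M + ℓmax + 4 + ⌈(1 / (1 - (p : ℝ)) ^ (2 * d * LData.Ncont d M k)) / δ⌉₊ ≤ R)
    (W : Sym2 (Site d) → unitInterval) (Sfin D : Finset (Site d)) (lo hi : Site d)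
    (T : Finset (Site d)) (o : Site d)
    (hfin : FinSupp W Sfin) (hsub : IsSubbox W p D) (hDS : D ⊆ Sfin) (ho : o ∈ Sfin) (hoD : o ∉ D)
    (hBR : Finset.Icc (lo - (R : Site d)) (hi + (R : Site d)) ⊆ D)
    (htgt : ∀ v ∈ Finset.Icc (lo - (R : Site d)) (hi + (R : Site d)), ∃ ℓ : ℕ, R ≤ ℓ ∧ ℓ ≤ ℓhi ∧
      ∃ g ∈ H, g.Qset ℓ v ⊆ D ∧ g.Fset ℓ v ⊆ T)
    (hTD : T ⊆ D) (hTne : T.Nonempty) :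
    (prodBernoulli W).real (⋃ b ∈ Finset.Icc lo hi, openConn o b) - 6 * δ ≤
      (prodBernoulli W).real (⋃ t ∈ T, openConn o t) := by
  classical
  set μ := prodBernoulli W with hμ
  -- `lo ≤ hi`, else `B = ∅` and the claim is trivial
  by_cases hlohi : lo ≤ hi
  swap
  · have : Finset.Icc lo hi = ∅ := Finset.Icc_eq_empty hlohi
    rw [this]
    simp only [Finset.notMem_empty, Set.iUnion_of_empty, Set.iUnion_empty, measureReal_empty]
    linarith [(measureReal_nonneg : 0 ≤ μ.real (⋃ t ∈ T, openConn o t))]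
  -- the number of contacts `N`, of levels
  set N := LData.Ncont d M k with hN
  set K₀ : ℝ := 1 / (1 - (p : ℝ)) ^ (2 * d * N) with hK₀
  set Lcount : ℕ := ⌈K₀ / δ⌉₊ + 1 with hLcount
  set j₀ : ℕ := 2 * M + 2 with hj₀
  set j₁ : ℕ := j₀ + Lcount - 1 with hj₁
  -- the level data and hypotheses
  set L : LData d := ⟨lo, hi, o, Sfin⟩ with hLdef
  have hL : LHyp L W p D (R - 1) :=
    { sub := hsub
      fin := hfin
      DS := hDS
      encl := by
        have : R - 1 + 1 = R := by omega
        rw [this]; exact hBR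
      o_not := hoD
      o_mem := ho }
  -- Step II (defect form)
  have hj₁R : j₁ ≤ R - 1 := by omega
  have hcard : ((Finset.Icc j₀ j₁).card : ℝ) = Lcount := by
    rw [Nat.card_Icc]; congr 1; omega
  have hJ : 1 / (1 - (p : ℝ)) ^ (2 * d * N) ≤ δ * ((Finset.Icc j₀ j₁).card : ℝ) := by
    rw [hcard, hLcount]
    push_cast
    have h1 : K₀ / δ ≤ ⌈K₀ / δ⌉₊ := Nat.le_ceil _
    have h2 : K₀ = δ * (K₀ / δ) := by field_simp
    rw [← hK₀]
    nlinarith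
  obtain ⟨j, hjJ, hII⟩ := stepII_defect hL hp1 (N := N) hj₁R hJ
  obtain ⟨hj₀j, hjj₁⟩ := Finset.mem_Icc.1 hjJ
  have hjR : j ≤ R - 1 := hjj₁.trans hj₁R
  have hjM : 2 * M + 2 ≤ j := hj₀j
  have hwide : ∀ k', L.Lo j k' + 2 * M + 2 ≤ L.Hi j k' := by
    intro k'
    simp only [LData.Lo, LData.Hi, Pi.sub_apply, Pi.add_apply, Pi.natCast_apply]
    have : L.lo k' ≤ L.hi k' := hlohi k'
    omega
  -- the shell
  set S := L.X (j - 1) \ L.X (j - (2 * M + 2)) with hSdef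
  have hS : S ⊆ Finset.Icc (L.Lo j + 1) (L.Hi j - 1) := LData.shell_subset_shrink (by omega)
  have hSD : S ⊆ D := (Finset.sdiff_subset).trans (hL.X_subset_D (by omega))
  have hmM' : m ≤ M := hmM.le
  -- the faces lie in the shell
  have hUS : ∀ x ∈ outerBoundary (zdGraph d) (L.X j), L.ufaceX j M x ⊆ S := by
    intro x hx
    obtain ⟨h, -⟩ := LData.winData_spec hwide hx
    refine (uface_subset_cube h).trans ?_
    change L.cubeX j M x ⊆ S
    rw [LData.cubeX_eq_ball]
    exact LData.ball_vX_subset_shell hjM hwide hx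
  -- Step IV at every contact vertex: a relay reliable to `T` inside `D`
  have hIV : ∀ x ∈ outerBoundary (zdGraph d) (L.X j),
      1 - 3 * δ ≤ μ.real {ω | ∃ u ∈ L.ufaceX j M x,
        1 - δ < (prodBernoulli (pinW W (wireSet (↑S : Set (Site d))) ω)).real
          (⋃ t ∈ T, openConnIn (↑D : Set (Site d)) u t)} := by
    intro x hx
    set v := L.vX j M x with hv
    have hballS : GM.ball v M ⊆ S := LData.ball_vX_subset_shell hjM hwide hx
    have hballD : (↑(GM.ball v M) : Set (Site d)) ⊆ ↑D := Finset.coe_subset.2 (hballS.trans hSD)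
    -- the target route from `v`
    have hvB : v ∈ Finset.Icc (lo - (R : Site d)) (hi + (R : Site d)) := by
      have := LData.vX_mem (L := L) (by omega) hwide hx
      exact Icc_enlarge_mono (show j - 1 ≤ R by omega) this
    obtain ⟨ℓ, hRℓ, hℓhi, g, hg, hQ, hF⟩ := htgt v hvB
    have hMℓ : M < ℓ := lt_of_lt_of_le (by omega) hRℓ
    -- (1) uniqueness zone
    have h1 : 1 - δ ^ 2 < μ.real (uniqZoneAt v m M) := by
      rw [hμ, hsub.real_eq_bondPercolation (determinedBy_uniqZoneAt v m M (wireSet_mono hballD))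
        (measurableSet_uniqZoneAt v m M), real_uniqZoneAt_eq]
      exact huniq
    -- (2) the face
    have h2 : 1 - δ ^ 2 < μ.real (linkIn (↑(GM.ball v M)) (GM.ball v m) (L.ufaceX j M x)) := by
      obtain ⟨a, τ, hsubU⟩ := LData.orthantFace_image_subset_ufaceX hwide hx
      have hmono : linkIn (↑(GM.ball v M)) (GM.ball v m) ((orthantFace a τ M).image (· + v)) ⊆
          linkIn (↑(GM.ball v M)) (GM.ball v m) (L.ufaceX j M x) := linkIn_mono le_rfl le_rfl hsubU
      refine lt_of_lt_of_le ?_ (measureReal_mono hmono)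
      rw [hμ, hsub.real_eq_bondPercolation (determinedBy_linkIn _ _ _ (wireSet_mono hballD))]
      · have e1 : GM.ball v M = (box d M).image (· + v) := rfl
        have e2 : GM.ball v m = (box d m).image (· + v) := rfl
        rw [e1, e2, real_linkIn_image_add]
        exact hface a τ
      · exact measurableSet_linkIn _ _ _
    -- (3) the target route
    have h3 : 1 - δ ^ 2 < μ.real (linkIn (↑(g.Qset ℓ v)) (GM.ball v m) (g.Fset ℓ v)) := by
      rw [hμ, hsub.real_eq_bondPercolation (determinedBy_linkIn _ _ _ (wireSet_mono (Finset.coe_subset.2 hQ)))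
        (measurableSet_linkIn _ _ _)]
      have e2 : GM.ball v m = (box d m).image (· + v) := rfl
      rw [g.Qset_eq_image ℓ v, g.Fset_eq_image ℓ v, e2, real_linkIn_image_add]
      exact hhit g hg ℓ (le_trans (by omega) hRℓ) hℓhi
    exact stepIV_in (S := S) hsub hF hQ hmM' hballS (LData.ufaceX_subset_innerBoundary hwide hx)
      (g.disjoint_Fset_ball hMℓ v) hδ (Rg := (↑D : Set (Site d))) hballD (Finset.coe_subset.2 hQ) h1 h2 h3
  -- Step V (additive)
  have hV := stepV_additive hL (Rg := (↑D : Set (Site d))) hjR hwide hS hSD (hTD.trans hDS) hTne hδ hII hk hUS hIV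
  exact hV

/-- **Kozma–Nitzan's Lemma 10 with ADDITIVE loss `6δ`** for targets in the tree's sense (`KozmaNitzan.IsTarget`:
route scales `ℓ ≥ R`, unbounded), from the hypotheses of `targetLemma_additive_core` with hittability (a) on the
unbounded range `ℓ ≥ ℓmax` (the matrix of the lane's `AdditiveTargetPropertyAt d p (6δ) H R`, stated unbundled):
`P_W(o ↔ B) − 6δ ≤ P_W(o ↔ T)`.
builds on p205010 (kernel theorem, internal audit signed; external expert review pending).
[cite: KozmaNitzan2024, §4 Lemma 10 (pp. 17–22)] -/
theorem targetLemma_additive [NeZero d] (p : unitInterval) (hp1 : (p : ℝ) < 1)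
    {δ : ℝ} (hδ : 0 < δ) (H : List (Geom d)) {m M ℓmax k R : ℕ} (hmM : m < M)
    (hhit : ∀ g ∈ H, ∀ ℓ : ℕ, ℓmax ≤ ℓ →
      1 - δ ^ 2 < (bondPercolation (zdGraph d) p).real (linkIn (↑(g.Qset ℓ 0)) (box d m) (g.Fset ℓ 0)))
    (hface : ∀ (a : Fin d) (τ : Fin d → ℤˣ),
      1 - δ ^ 2 < (bondPercolation (zdGraph d) p).real (linkEvent (box d m) (orthantFace a τ M) M))
    (huniq : 1 - δ ^ 2 < (bondPercolation (zdGraph d) p).real (uniqZone m M))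
    (hk : (1 - (p : ℝ) ^ seedBound d M) ^ k ≤ δ)
    (hR : 3 * M + ℓmax + 4 + ⌈(1 / (1 - (p : ℝ)) ^ (2 * d * LData.Ncont d M k)) / δ⌉₊ ≤ R)
    (W : Sym2 (Site d) → unitInterval) (Sfin D : Finset (Site d)) (lo hi : Site d)
    (T : Finset (Site d)) (o : Site d)
    (hfin : FinSupp W Sfin) (hsub : IsSubbox W p D) (hDS : D ⊆ Sfin) (ho : o ∈ Sfin) (hoD : o ∉ D)
    (hBR : Finset.Icc (lo - (R : Site d)) (hi + (R : Site d)) ⊆ D)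
    (htgt : IsTarget T lo hi D R H) (hTD : T ⊆ D) (hTne : T.Nonempty) :
    (prodBernoulli W).real (⋃ b ∈ Finset.Icc lo hi, openConn o b) - 6 * δ ≤
      (prodBernoulli W).real (⋃ t ∈ T, openConn o t) := by
  classical
  -- choose a route for every `v ∈ B⟨R⟩` and bound the finitely many chosen scales by their maximum `ℓhi`
  have hch : ∀ v ∈ Finset.Icc (lo - (R : Site d)) (hi + (R : Site d)), ∃ ℓ : ℕ, R ≤ ℓ ∧
      ∃ g ∈ H, g.Qset ℓ v ⊆ D ∧ g.Fset ℓ v ⊆ T := htgt.hit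
  choose! ℓof hℓof using hch
  set ℓhi := (Finset.Icc (lo - (R : Site d)) (hi + (R : Site d))).sup ℓof with hℓhi
  refine targetLemma_additive_core p hp1 hδ H (ℓhi := ℓhi) hmM (fun g hg ℓ hℓ _ => hhit g hg ℓ hℓ) hface huniq hk
    hR W Sfin D lo hi T o hfin hsub hDS ho hoD hBR (fun v hv => ?_) hTD hTne
  obtain ⟨hRℓ, g, hg, hQ, hF⟩ := hℓof v hv
  exact ⟨ℓof v, hRℓ, Finset.le_sup (f := ℓof) hv, g, hg, hQ, hF⟩

/-- **Kozma–Nitzan's Lemma 10 EFFECTIVE, threshold form** (the lane's R2.a): under the scale-indexed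
hypotheses (a)–(e) of `targetLemma_additive_core`, `P_W(o ↔ B) > 1 − δ ⟹ P_W(o ↔ T) > 1 − 7δ`, i.e.
`TargetPropertyAt d p (7δ) δ H R` — the tolerance is LINEAR in `ε` (`δ = ε/7`; the tree's Conjecture-3-based
constant is `ε·min(ε/4,1)/12`), and the margin `R` is explicit in `(M, k, ℓmax, δ)`.
builds on p205010 (kernel theorem, internal audit signed; external expert review pending).
[cite: KozmaNitzan2024, §4 Lemma 10 (pp. 17–22)] -/
theorem targetLemma_effective [NeZero d] (p : unitInterval) (hp1 : (p : ℝ) < 1)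
    {δ : ℝ} (hδ : 0 < δ) (H : List (Geom d)) {m M ℓmax k R : ℕ} (hmM : m < M)
    (hhit : ∀ g ∈ H, ∀ ℓ : ℕ, ℓmax ≤ ℓ →
      1 - δ ^ 2 < (bondPercolation (zdGraph d) p).real (linkIn (↑(g.Qset ℓ 0)) (box d m) (g.Fset ℓ 0)))
    (hface : ∀ (a : Fin d) (τ : Fin d → ℤˣ),
      1 - δ ^ 2 < (bondPercolation (zdGraph d) p).real (linkEvent (box d m) (orthantFace a τ M) M))
    (huniq : 1 - δ ^ 2 < (bondPercolation (zdGraph d) p).real (uniqZone m M))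
    (hk : (1 - (p : ℝ) ^ seedBound d M) ^ k ≤ δ)
    (hR : 3 * M + ℓmax + 4 + ⌈(1 / (1 - (p : ℝ)) ^ (2 * d * LData.Ncont d M k)) / δ⌉₊ ≤ R) :
    TargetPropertyAt d p (7 * δ) δ H R := by
  intro W Sfin D lo hi T o hfin hsub hDS ho hoD hBR htgt hTD hTne hreach
  have h := targetLemma_additive p hp1 hδ H hmM hhit hface huniq hk hR W Sfin D lo hi T o hfin hsub hDS ho hoD hBR
    htgt hTD hTne
  linarith

/-- **The typer's R2.a obligation `KNLemma10EffectiveAt d p`, DISCHARGED** (file `…QuantTargetPropertyAt.lean`,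
`@[conjecture]` there): with `δ = lemma10Delta ε = ε·min(ε/4,1)/12` and the radius `lemma10Radius d p δ M ℓH k`, the
four finite-volume hypotheses (F1)–(F4) at parameter `p` give `TargetPropertyAt d p ε δ H R`.  Proof:
`targetLemma_effective` gives the stronger `TargetPropertyAt d p (7δ) δ H R` and `7δ ≤ ε`; `d = 0` is vacuous
(`B⟨R⟩` is then the whole one-point site type, so `o ∉ D ⊇ B⟨R⟩` is impossible).
builds on p205010 (kernel theorem, internal audit signed; external expert review pending).
[cite: KozmaNitzan2024, §4 Lemma 10 (pp. 17–22)] -/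
theorem knLemma10EffectiveAt_holds (d : ℕ) (p : unitInterval) : KNLemma10EffectiveAt d p := by
  intro hp0 hp1 ε hε H m M ℓH k hmM hF1 hF2 hF3 hF4
  rcases Nat.eq_zero_or_pos d with rfl | hd
  · -- `d = 0`: the site type is a point, `B⟨R⟩ ∋ o`, contradiction with `o ∉ D`
    intro W Sfin D lo hi T o hfin hsub hDS ho hoD hBR htgt hTD hTne hreach
    exact absurd (hBR (Finset.mem_Icc.2 ⟨fun i => i.elim0, fun i => i.elim0⟩)) hoD
  haveI : NeZero d := ⟨hd.ne'⟩
  have hδ : 0 < lemma10Delta ε := by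
    unfold lemma10Delta
    have : 0 < min (ε / 4) 1 := lt_min (by positivity) one_pos
    positivity
  have h7 : 7 * lemma10Delta ε ≤ ε := by
    unfold lemma10Delta
    have : min (ε / 4) 1 ≤ 1 := min_le_right _ _
    nlinarith
  have hT := targetLemma_effective p hp1 hδ H hmM hF3 hF1 hF2 hF4.le
    (R := lemma10Radius d p (lemma10Delta ε) M ℓH k) (by unfold lemma10Radius; omega)
  intro W Sfin D lo hi T o hfin hsub hDS ho hoD hBR htgt hTD hTne hreach
  have := hT W Sfin D lo hi T o hfin hsub hDS ho hoD hBR htgt hTD hTne hreach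
  linarith

/-- **Sanity link: the effective hypotheses are exactly what Kozma–Nitzan's limit lemmas provide.**  For
`0 < p < 1` with `θ(p) > 0`, Lemma 9 (`exists_forall_lt_real_linked_orthantFace`), Lemma 7
(`exists_forall_le_lt_real_uniqZone`), the hittability thresholds and `exists_pow_lt_of_lt_one` discharge
(a)–(e), so `targetLemma_effective` recovers the tree's `KozmaNitzan.TargetProperty d p` — now from the proved
additive gluing inequality instead of Conjecture 3, and with `δ(ε) = ε/7`.
builds on p205010 (kernel theorem, internal audit signed; external expert review pending).
[cite: KozmaNitzan2024, §4 Lemma 10 (pp. 17–22)] -/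
theorem targetProperty_of_theta_pos [NeZero d] (p : unitInterval) (hp0 : 0 < (p : ℝ)) (hp1 : (p : ℝ) < 1)
    (hθ : 0 < theta (zdGraph d) 0 p) : TargetProperty d p := by
  classical
  intro ε hε
  set δ : ℝ := ε / 7 with hδdef
  have hδ : 0 < δ := by positivity
  refine ⟨δ, hδ, fun H hH => ?_⟩
  have hη : 0 < δ ^ 2 := by positivity
  -- hittability thresholds of the geometries of `H`
  have hkl : ∀ g ∈ H, ∃ kl : ℕ × ℕ, ∀ m, kl.1 ≤ m → ∀ ℓ, kl.2 ≤ ℓ →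
      1 - δ ^ 2 < (bondPercolation (zdGraph d) p).real (linkIn (↑(g.Qset ℓ 0)) (box d m) (g.Fset ℓ 0)) := by
    intro g hg
    obtain ⟨k, ℓ₀, h⟩ := (hH g hg).hit (δ ^ 2) hη
    exact ⟨(k, ℓ₀), h⟩
  choose! kl hklspec using hkl
  have le_foldr_max_of_mem : ∀ {l : List ℕ} {a : ℕ}, a ∈ l → a ≤ l.foldr max 0 := by
    intro l
    induction l with
    | nil => intro a h; exact absurd h List.not_mem_nil
    | cons b l ih =>
      intro a h
      rw [List.foldr_cons]
      rcases List.mem_cons.1 h with rfl | h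
      · exact le_max_left _ _
      · exact (ih h).trans (le_max_right _ _)
  set k₀ := (H.map fun g => (kl g).1).foldr max 0 with hk₀
  set ℓmax := (H.map fun g => (kl g).2).foldr max 0 with hℓmax
  have hk₀le : ∀ g ∈ H, (kl g).1 ≤ k₀ := fun g hg => le_foldr_max_of_mem (List.mem_map.2 ⟨g, hg, rfl⟩)
  have hℓle : ∀ g ∈ H, (kl g).2 ≤ ℓmax := fun g hg => le_foldr_max_of_mem (List.mem_map.2 ⟨g, hg, rfl⟩)
  -- the scales `m < M`
  obtain ⟨m, hmk₀, n₁, hmn₁, hface⟩ := exists_forall_lt_real_linked_orthantFace p hθ hp1 hη k₀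
  obtain ⟨n₂, huniq⟩ := exists_forall_le_lt_real_uniqZone p m hη
  set M := max n₁ n₂ with hM
  have hmM : m < M := hmn₁.trans_le (le_max_left _ _)
  -- the seed count `k`
  set q : ℝ := 1 - (p : ℝ) ^ seedBound d M with hq
  have hq1 : q < 1 := by rw [hq]; linarith [pow_pos hp0 (seedBound d M)]
  obtain ⟨k, hk⟩ := exists_pow_lt_of_lt_one hδ hq1
  set R : ℕ := 3 * M + ℓmax + 4 + ⌈(1 / (1 - (p : ℝ)) ^ (2 * d * LData.Ncont d M k)) / δ⌉₊ with hR
  refine ⟨R, ?_⟩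
  have h7 : 7 * δ = ε := by rw [hδdef]; ring
  have hT := targetLemma_effective p hp1 hδ H hmM
    (fun g hg ℓ hℓ => hklspec g hg m ((hk₀le g hg).trans hmk₀) ℓ ((hℓle g hg).trans hℓ))
    (fun a τ => hface M (le_max_left _ _) a τ) (huniq M (le_max_right _ _)) hk.le le_rfl
  rwa [h7] at hT

end Summit.CriticalPhenomena.PercolationContinuityZ3.Theorems.Quant

end
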